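/-
Origin: expansion seat `prover-pub-hodgecm-mc-binder-1-g12-0`, handover #60 2026-08-20T11:46:38Z md5 df6bdeaa66b5 (NEW additive KERNEL leaf; imports #59 + vendored AdelicMetaplecticReindex; drop rules #58 ⇒ {#59 #60}, #59 ⇒ {#60}) (`HOME/mc/pub-hodgecm-mc-binder-1-g12/stage50/HodgeCM/Model/Binders/Real34ScaledFrameSum.lean`, md5 df6bdeaa66b5, 149 lines);
landed by the second packager p2 gen 7 (p2-g7) in gate run 50 as `HodgeCM/Model/Binders/Real34ScaledFrameSum.lean` (verbatim).
-/
/-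
Origin: pub-hodgecm MODEL-CONSTRUCTION sub-cell (Hodge conjecture, CM-per-L package), seat mc-binder-1 gen 12, session
prover-pub-hodgecm-mc-binder-1-g12-0, 2026-08-20.  Target in PKG: HodgeCM/Model/Binders/Real34ScaledFrameSum.lean (NEW additive leaf; imports RUN-50 #59
`Binders/Real34ScaledFrameSubst` + vendored `Weil1964/AdelicMetaplecticReindex`).  KERNEL MATHEMATICS ONLY: no `def … : Prop`, no `axiom`, no proof hole.
Consumer: the archimedean letter identity `harch` of the row-17 socket (#56 `Binders/Real34Census`), ingredient (ii″) of
`mc/pub-hodgecm-mc-binder-1-g12/HARCH-PLAN.md` §5/§6: the LINE side of (A″) — box tensors and reindexings of Folland letters of SCALED frames.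
-/
import Summits.HodgeConjecture.HodgeCM.Model.Binders.Real34ScaledFrameSubst
import Literature.NumberTheory.Weil1964.AdelicMetaplecticReindex

/-!
# Row 17 (`real34`), archimedean letters: sums and reindexings of scaled Folland frames

For a totally real `F` and the tree's scaled real-place frames `scaledFrame F ι D hD` (`Weil1964/ArchFollandTorusAdelic`):

* §1 `sumScale D₁ D₂` and **`sumFrame_scaledFrame`**: the sum frame (#57 `sumFrame`) of two scaled frames, relabelled along
  `(Equiv.sumProdDistrib ι₁ ι₂ _)⁻¹ : (ι₁ × pl) ⊕ (ι₂ × pl) ≃ (ι₁ ⊕ ι₂) × pl`, IS the scaled frame of `ι₁ ⊕ ι₂` with the juxtaposed scalings; hence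
  **`archBoxTensor_follandFock_scaledFrame`**: `follandFock (scaledFrame D₁) P ⊠ follandFock (scaledFrame D₂) Q =
  follandFock (scaledFrame (sumScale D₁ D₂)) (rename sumProdDistrib⁻¹ (P(z_inl) · Q(z_inr)))` (#58 `archBoxTensor_follandFock_relabel`);
* §2 `reindexScale e D` and **`schwartzReindexCLM_follandFock_scaledFrame`**: the archimedean reindexing operator `R_e φ = φ ∘ (· ∘ e)` of the tree
  (`Weil1964/AdelicMetaplecticReindex.schwartzReindexCLM`, the one inside #55's `Tinf`) maps a Folland letter of `scaledFrame F ι D` to the Folland letter of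
  `scaledFrame F ι' (reindexScale e D)` with the polynomial renamed along `(i, v) ↦ (e i, v)`.

With #59 (the census side `S_m (follandFock cmBigFrame P)`) and carch's installed bridge `blockFamilyOfAt_degOnePDual_binvPi_one` (each line letter
`Z_k (proj a)` is `follandFock (scaledFrame L⁺ (Fin 3) (pairScale 3 1 …)) (explicit polynomial)`, `Model/ArchLineDatumOf`), every archimedean vector in `harch` is
now a Folland letter of ONE scaled frame of `Fin 6 × places` and (A″) is an identity of polynomials (HARCH-PLAN §5 (4)).

## References
* [Folland1989] G. B. Folland, *Harmonic Analysis in Phase Space*, Princeton UP (1989), §1.6–§1.7.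
-/

set_option autoImplicit false

noncomputable section

open NumberField NumberField.InfinitePlace NumberField.mixedEmbedding MvPolynomial
open Literature.Analysis.SegalBargmann Literature.NumberTheory.Weil1964 Literature.NumberTheory.Automorphic

namespace HodgeCM.Model

open scoped Classical

/-! ## §1 The sum of two scaled frames -/

section Sum

variable {F : Type} [Field F] {ι₁ ι₂ : Type}

/-- Juxtaposed scalings on `(ι₁ ⊕ ι₂) × places`: `D₁` on the `inl` indices, `D₂` on the `inr` indices. [folklore] -/
def sumScale (D₁ : ι₁ × {v : InfinitePlace F // v.IsReal} → ℝ) (D₂ : ι₂ × {v : InfinitePlace F // v.IsReal} → ℝ) :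
    (ι₁ ⊕ ι₂) × {v : InfinitePlace F // v.IsReal} → ℝ :=
  fun k => Sum.elim (fun i => D₁ (i, k.2)) (fun i => D₂ (i, k.2)) k.1

/-- see `sumScale`. [folklore] -/
@[simp] theorem sumScale_inl (D₁ : ι₁ × {v : InfinitePlace F // v.IsReal} → ℝ) (D₂ : ι₂ × {v : InfinitePlace F // v.IsReal} → ℝ)
    (i : ι₁) (v : {v : InfinitePlace F // v.IsReal}) : sumScale D₁ D₂ (Sum.inl i, v) = D₁ (i, v) := rfl

/-- see `sumScale`. [folklore] -/
@[simp] theorem sumScale_inr (D₁ : ι₁ × {v : InfinitePlace F // v.IsReal} → ℝ) (D₂ : ι₂ × {v : InfinitePlace F // v.IsReal} → ℝ)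
    (i : ι₂) (v : {v : InfinitePlace F // v.IsReal}) : sumScale D₁ D₂ (Sum.inr i, v) = D₂ (i, v) := rfl

/-- The juxtaposed scalings are non-zero if both are. [folklore] -/
theorem sumScale_ne_zero {D₁ : ι₁ × {v : InfinitePlace F // v.IsReal} → ℝ} {D₂ : ι₂ × {v : InfinitePlace F // v.IsReal} → ℝ}
    (hD₁ : ∀ k, D₁ k ≠ 0) (hD₂ : ∀ k, D₂ k ≠ 0) : ∀ k, sumScale D₁ D₂ k ≠ 0 := by
  rintro ⟨i | i, v⟩
  · exact hD₁ (i, v)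
  · exact hD₂ (i, v)

variable [NumberField F] [IsTotallyReal F] [Fintype ι₁] [Fintype ι₂]

/-- **The sum of two scaled frames is the scaled frame of the sum** (relabelled along `sumProdDistrib⁻¹`), pointwise. [folklore] -/
theorem sumFrame_scaledFrame_apply {D₁ : ι₁ × {v : InfinitePlace F // v.IsReal} → ℝ} {D₂ : ι₂ × {v : InfinitePlace F // v.IsReal} → ℝ}
    (hD₁ : ∀ k, D₁ k ≠ 0) (hD₂ : ∀ k, D₂ k ≠ 0) (x : ι₁ ⊕ ι₂ → mixedSpace F) (k : (ι₁ ⊕ ι₂) × {v : InfinitePlace F // v.IsReal}) :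
    sumFrame (scaledFrame F ι₁ D₁ hD₁) (scaledFrame F ι₂ D₂ hD₂) x (Equiv.sumProdDistrib ι₁ ι₂ _ k) =
      scaledFrame F (ι₁ ⊕ ι₂) (sumScale D₁ D₂) (sumScale_ne_zero hD₁ hD₂) x k := by
  obtain ⟨i | i, v⟩ := k
  · rw [Equiv.sumProdDistrib_apply_left, sumFrame_apply_inl, scaledFrame_apply, scaledFrame_apply, sumScale_inl]
  · rw [Equiv.sumProdDistrib_apply_right, sumFrame_apply_inr, scaledFrame_apply, scaledFrame_apply, sumScale_inr]

/-- **The sum of two scaled frames is the scaled frame of the sum**, as continuous linear equivalences: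
`sumFrame (scaledFrame D₁) (scaledFrame D₂) ≫ relabelCLE sumProdDistrib⁻¹ = scaledFrame (sumScale D₁ D₂)`. [folklore] -/
theorem sumFrame_scaledFrame {D₁ : ι₁ × {v : InfinitePlace F // v.IsReal} → ℝ} {D₂ : ι₂ × {v : InfinitePlace F // v.IsReal} → ℝ}
    (hD₁ : ∀ k, D₁ k ≠ 0) (hD₂ : ∀ k, D₂ k ≠ 0) :
    (sumFrame (scaledFrame F ι₁ D₁ hD₁) (scaledFrame F ι₂ D₂ hD₂)).trans (relabelCLE (Equiv.sumProdDistrib ι₁ ι₂ _).symm) =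
      scaledFrame F (ι₁ ⊕ ι₂) (sumScale D₁ D₂) (sumScale_ne_zero hD₁ hD₂) := by
  ext x k
  rw [ContinuousLinearEquiv.trans_apply, relabelCLE_apply, Equiv.symm_symm, sumFrame_scaledFrame_apply]

variable [DecidableEq ι₁] [DecidableEq ι₂]

/-- **Box tensor of Folland letters of scaled frames** = the Folland letter of the scaled frame of the sum:
`follandFock (scaledFrame D₁) P ⊠ follandFock (scaledFrame D₂) Q = follandFock (scaledFrame (sumScale D₁ D₂)) (rename sumProdDistrib⁻¹ (P(z_inl) · Q(z_inr)))`.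
[cite: Folland1989, §1.6–§1.7] -/
theorem archBoxTensor_follandFock_scaledFrame {D₁ : ι₁ × {v : InfinitePlace F // v.IsReal} → ℝ}
    {D₂ : ι₂ × {v : InfinitePlace F // v.IsReal} → ℝ} (hD₁ : ∀ k, D₁ k ≠ 0) (hD₂ : ∀ k, D₂ k ≠ 0)
    (P : MvPolynomial (ι₁ × {v : InfinitePlace F // v.IsReal}) ℂ) (Q : MvPolynomial (ι₂ × {v : InfinitePlace F // v.IsReal}) ℂ) :
    archBoxTensor (follandFock (scaledFrame F ι₁ D₁ hD₁) P) (follandFock (scaledFrame F ι₂ D₂ hD₂) Q) =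
      follandFock (scaledFrame F (ι₁ ⊕ ι₂) (sumScale D₁ D₂) (sumScale_ne_zero hD₁ hD₂))
        (rename (Equiv.sumProdDistrib ι₁ ι₂ _).symm (rename Sum.inl P * rename Sum.inr Q)) := by
  rw [archBoxTensor_follandFock_relabel (Equiv.sumProdDistrib ι₁ ι₂ _).symm, sumFrame_scaledFrame]

end Sum

/-! ## §2 Reindexing a scaled frame -/

section Reindex

variable {F : Type} [Field F] {ι ι' : Type}

/-- Reindexed scalings: `reindexScale e D (i', v) = D (e⁻¹ i', v)`. [folklore] -/
def reindexScale (e : ι ≃ ι') (D : ι × {v : InfinitePlace F // v.IsReal} → ℝ) : ι' × {v : InfinitePlace F // v.IsReal} → ℝ :=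
  fun k => D (e.symm k.1, k.2)

/-- see `reindexScale`. [folklore] -/
@[simp] theorem reindexScale_apply (e : ι ≃ ι') (D : ι × {v : InfinitePlace F // v.IsReal} → ℝ)
    (k : ι' × {v : InfinitePlace F // v.IsReal}) : reindexScale e D k = D (e.symm k.1, k.2) := rfl

/-- Reindexed non-zero scalings are non-zero. [folklore] -/
theorem reindexScale_ne_zero (e : ι ≃ ι') {D : ι × {v : InfinitePlace F // v.IsReal} → ℝ} (hD : ∀ k, D k ≠ 0) :
    ∀ k, reindexScale e D k ≠ 0 := fun _ => hD _

variable [NumberField F] [IsTotallyReal F] [Fintype ι] [Fintype ι']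

/-- A scaled frame evaluated at a reindexed vector: `scaledFrame D (w ∘ e) = (scaledFrame (reindexScale e D) w) ∘ ((i, v) ↦ (e i, v))`. [folklore] -/
theorem scaledFrame_comp_equiv (e : ι ≃ ι') {D : ι × {v : InfinitePlace F // v.IsReal} → ℝ} (hD : ∀ k, D k ≠ 0)
    (w : ι' → mixedSpace F) :
    scaledFrame F ι D hD (w ∘ e) =
      scaledFrame F ι' (reindexScale e D) (reindexScale_ne_zero e hD) w ∘ (e.prodCongr (Equiv.refl _)) := by
  funext k
  obtain ⟨i, v⟩ := k
  simp only [scaledFrame_apply, Function.comp_apply, Equiv.prodCongr_apply, Prod.map_apply, Equiv.coe_refl, id_eq,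
    reindexScale_apply, Equiv.symm_apply_apply]

variable [DecidableEq ι] [DecidableEq ι']

/-- **The archimedean reindexing operator on a Folland letter of a scaled frame**:
`R_e (follandFock (scaledFrame D) P) = follandFock (scaledFrame (reindexScale e D)) (rename ((i, v) ↦ (e i, v)) P)`. [cite: Folland1989, §1.7 (1.81)] -/
theorem schwartzReindexCLM_follandFock_scaledFrame (e : ι ≃ ι') {D : ι × {v : InfinitePlace F // v.IsReal} → ℝ} (hD : ∀ k, D k ≠ 0)
    (P : MvPolynomial (ι × {v : InfinitePlace F // v.IsReal}) ℂ) :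
    schwartzReindexCLM F e (follandFock (scaledFrame F ι D hD) P) =
      follandFock (scaledFrame F ι' (reindexScale e D) (reindexScale_ne_zero e hD)) (rename (e.prodCongr (Equiv.refl _)) P) := by
  ext w
  rw [schwartzReindexCLM_apply, follandFock_apply, follandFock_rename_equiv_apply, scaledFrame_comp_equiv]

end Reindex

end HodgeCM.Model

end
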